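import Summits.HubbardSuperconductivity.HubbardSuperconductivity.Theorems.AnisotropyChordKnnRatio
import Summits.HubbardSuperconductivity.HubbardSuperconductivity.Theorems.AnisotropyChordKnnMLR

/-!
# Route `AnisotropyChord` / H0 rotor rung, K_{n,n} sibling of XY-LM₀: square-root-free COUPLING BOUNDS and the
# ratio-majorant criterion for the budget condition (S_M)
(prover seat `hubbard-h0-rotor-p1` g16; instantiates the generic `rayleigh_sub_le_horner` of `…KnnRatio` on the
two-big-spin block `knnBlock`)

* `cUK`: AM–GM majorant `(η/8)(b²_J + b²_{J+1}) ≥ c = (η/4) b_J b_{J+1}` of the coupling (`cK_le_cUK`);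
* `dK`: the exact diagonal drop `p_J(M) − p_J(M+1) ≥ 0` between adjacent sectors (`dK_nonneg`);
* `dcUK`: a square-root-free majorant of the coupling drop `c_J(M) − c_J(M+1)`,
  `(η/4)(2M+1)·½(β²_J + β²_{J+1})·(x′+y′)²/(4x′y′)` with `x′ = (J+1)² − (M+1)²`, `y′ = (J+2)² − (M+1)²`
  (tangent bound for the concave `μ ↦ √(((J+1)²−μ)((J+2)²−μ))` plus two AM–GMs: `sqrt_mul_sub_sqrt_mul_le`, `cK_sub_le_dcUK`);
* **`budgetCondition_of_ratioBounds`**: ratio bounds `T_k` with positive brackets and `H_{m′−1} ≤ budget` ⇒ (S_M);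
* **`budgetCondition_of_ratioBounds_of_le`** (MONOTONE COVERAGE): the same hypotheses at `η₀` give (S_M) at every
  `0 < η ≤ η₀` — the bare level gaps `½(J′(J′+1) − J(J+1))` are `η`-free and everything else is `η`-linear, so the brackets
  at `η` dominate `(η/η₀)`× those at `η₀` with the ratio bounds frozen.
-/

set_option linter.dupNamespace false
set_option autoImplicit false

noncomputable section

open Finset Matrix

namespace Summit.HubbardSuperconductivity.HubbardSuperconductivity.Theorems.AnisotropyChord.Knn

/-! ## Two real-analysis lemmas -/

/- AM–GM `√(ab) ≤ (a+b)/2` is inlined below where needed (it exists in the tree as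
`Literature.Analysis.FluidPDE.sqrt_mul_le_add_half`, whose module is too heavy to import here). -/

/-- **tangent bound:** `√((x+δ)(y+δ)) − √(xy) ≤ δ (x+y)²/(4xy)` for `x, y > 0`, `δ ≥ 0` (concavity of
`μ ↦ √((x₀−μ)(y₀−μ))`, then `1/√(xy) ≤ (x+y)/(2xy)`). [folklore] -/
theorem sqrt_mul_sub_sqrt_mul_le {x y δ : ℝ} (hx : 0 < x) (hy : 0 < y) (hδ : 0 ≤ δ) :
    Real.sqrt ((x + δ) * (y + δ)) - Real.sqrt (x * y) ≤ δ * (x + y) ^ 2 / (4 * x * y) := by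
  set g := Real.sqrt (x * y) with hg
  set S := Real.sqrt ((x + δ) * (y + δ)) with hS
  have hxy : 0 < x * y := mul_pos hx hy
  have hg0 : 0 < g := Real.sqrt_pos.mpr hxy
  have hg2 : g ^ 2 = x * y := Real.sq_sqrt hxy.le
  have hS0 : 0 ≤ S := Real.sqrt_nonneg _
  have hS2 : S ^ 2 = (x + δ) * (y + δ) := Real.sq_sqrt (by positivity)
  -- AM–GM: 2g ≤ x + y
  have hamgm : 2 * g ≤ x + y := by
    have amgm : ∀ a b : ℝ, 0 ≤ a → 0 ≤ b → Real.sqrt (a * b) ≤ (a + b) / 2 := by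
      intro a b ha hb
      have h : a * b ≤ ((a + b) / 2) ^ 2 := by nlinarith [sq_nonneg (a - b)]
      calc Real.sqrt (a * b) ≤ Real.sqrt (((a + b) / 2) ^ 2) := Real.sqrt_le_sqrt h
        _ = (a + b) / 2 := Real.sqrt_sq (by linarith)
    have := amgm x y hx.le hy.le
    rw [← hg] at this; linarith
  -- S ≥ g + δ
  have hSg : g + δ ≤ S := by
    have h1 : (g + δ) ^ 2 ≤ (x + δ) * (y + δ) := by nlinarith
    calc g + δ = Real.sqrt ((g + δ) ^ 2) := (Real.sqrt_sq (by linarith)).symm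
      _ ≤ S := Real.sqrt_le_sqrt h1
  -- key polynomial inequality: 4g²(u+δ) ≤ u²(2g+δ) for u = x+y ≥ 2g
  have hkey : 4 * g ^ 2 * (x + y + δ) ≤ (x + y) ^ 2 * (2 * g + δ) := by
    have hfac : (x + y) ^ 2 * (2 * g + δ) - 4 * g ^ 2 * (x + y + δ)
        = (x + y - 2 * g) * (2 * g * (x + y) + δ * (x + y + 2 * g)) := by ring
    have h1 : 0 ≤ x + y - 2 * g := by linarith
    have h2 : 0 ≤ 2 * g * (x + y) + δ * (x + y + 2 * g) := by positivity
    nlinarith [mul_nonneg h1 h2]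
  -- (4xy(S−g) − δu²)(S+g) ≤ 0
  have hprod : (4 * x * y * (S - g) - δ * (x + y) ^ 2) * (S + g) ≤ 0 := by
    have e1 : (4 * x * y * (S - g) - δ * (x + y) ^ 2) * (S + g)
        = 4 * g ^ 2 * (δ * (x + y) + δ ^ 2) - δ * (x + y) ^ 2 * (S + g) := by
      have : 4 * x * y = 4 * g ^ 2 := by rw [hg2]; ring
      rw [this]; nlinarith [hS2, hg2]
    rw [e1]
    have h3 : δ * (x + y) ^ 2 * (2 * g + δ) ≤ δ * (x + y) ^ 2 * (S + g) :=
      mul_le_mul_of_nonneg_left (by linarith) (by positivity)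
    nlinarith [mul_le_mul_of_nonneg_left hkey hδ]
  have hSg0 : 0 < S + g := by linarith
  rw [le_div_iff₀ (by positivity)]
  by_contra hcon
  have hcon' : 0 < 4 * x * y * (S - g) - δ * (x + y) ^ 2 := by linarith [not_le.mp hcon]
  nlinarith [mul_pos hcon' hSg0]

/-! ## Coupling majorant (AM–GM) -/

/-- `cU_k(M) = (η/8)(b²_{J_k} + b²_{J_k+1})`, the AM–GM majorant of the coupling `c_k(M)`. [folklore] -/
def cUK (n : ℕ) (M : ℤ) (η : ℝ) (k : ℕ) : ℝ := η / 8 * (bSq n M (lev n M k) + bSq n M (lev n M k + 1))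

/-- `c_k ≤ cU_k` (`η ≥ 0`). [folklore] -/
theorem cK_le_cUK (n : ℕ) (M : ℤ) {η : ℝ} (hη : 0 ≤ η) (k : ℕ) : cK n M η k ≤ cUK n M η k := by
  unfold cK cUK
  have hk := natAbs_le_lev n M k
  have h1 : 0 ≤ bSq n M (lev n M k) := bSq_nonneg (by omega)
  have h2 : 0 ≤ bSq n M (lev n M k + 1) := bSq_nonneg (by omega)
  have this : Real.sqrt (bSq n M (lev n M k) * bSq n M (lev n M k + 1))
      ≤ (bSq n M (lev n M k) + bSq n M (lev n M k + 1)) / 2 := by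
    have amgm : ∀ a b : ℝ, 0 ≤ a → 0 ≤ b → Real.sqrt (a * b) ≤ (a + b) / 2 := by
      intro a b ha hb
      have h : a * b ≤ ((a + b) / 2) ^ 2 := by nlinarith [sq_nonneg (a - b)]
      calc Real.sqrt (a * b) ≤ Real.sqrt (((a + b) / 2) ^ 2) := Real.sqrt_le_sqrt h
        _ = (a + b) / 2 := Real.sqrt_sq (by linarith)
    exact amgm _ _ h1 h2
  have h8 : η / 8 * (bSq n M (lev n M k) + bSq n M (lev n M k + 1))
      = η / 4 * ((bSq n M (lev n M k) + bSq n M (lev n M k + 1)) / 2) := by ring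
  rw [h8]; exact mul_le_mul_of_nonneg_left this (by positivity)

/-- `cU_k ≥ 0` (`η ≥ 0`). [folklore] -/
theorem cUK_nonneg (n : ℕ) (M : ℤ) {η : ℝ} (hη : 0 ≤ η) (k : ℕ) : 0 ≤ cUK n M η k := by
  unfold cUK
  have hk := natAbs_le_lev n M k
  exact mul_nonneg (by positivity) (add_nonneg (bSq_nonneg (by omega)) (bSq_nonneg (by omega)))

/-- `cU_k` is linear in `η`. [folklore] -/
theorem cUK_linear (n : ℕ) (M : ℤ) (η : ℝ) (k : ℕ) : cUK n M η k = η * cUK n M 1 k := by unfold cUK; ring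

/-! ## Diagonal drop -/

/-- the exact diagonal drop `d_k = p_{k+shift}(M) − p_k(M+1)` (same level `J`). [folklore] -/
def dK (n M : ℕ) (η : ℝ) (k : ℕ) : ℝ := pK n (M : ℤ) η (k + shift n M) - pK n ((M : ℤ) + 1) η k

/-- `bSqPred` is antitone in `|M|`. [folklore] -/
theorem bSqPred_antitone_abs {n : ℕ} {M M' : ℤ} (h : |M| ≤ |M'|) (J : ℕ) : bSqPred n M' J ≤ bSqPred n M J := by
  unfold bSqPred; split_ifs
  · exact le_rfl
  · exact bSq_antitone_abs h _

/-- `d_k ≥ 0` (`η ≥ 0`): the diagonal shrinks with `|M|`. [folklore] -/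
theorem dK_nonneg (n M : ℕ) {η : ℝ} (hη : 0 ≤ η) (k : ℕ) : 0 ≤ dK n M η k := by
  unfold dK pK
  rw [← lev_succ]
  set J := lev n ((M : ℤ) + 1) k
  have habs : |(M : ℤ)| ≤ |(M : ℤ) + 1| := by
    rw [abs_of_nonneg (by positivity), abs_of_nonneg (by positivity)]; linarith
  have h1 := bSqPred_antitone_abs (n := n) habs J
  have h2 := bSq_antitone_abs (twoS := n) habs J
  nlinarith

/-- `d_k` is linear in `η`. [folklore] -/
theorem dK_linear (n M : ℕ) (η : ℝ) (k : ℕ) : dK n M η k = η * dK n M 1 k := by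
  unfold dK pK; rw [← lev_succ]; ring

/-! ## Coupling-drop majorant -/

/-- `x′_J = (J+1)² − (M+1)²`. [folklore] -/
def xLev (J M : ℕ) : ℝ := ((J : ℝ) + 1) ^ 2 - ((M : ℝ) + 1) ^ 2

/-- `y′_J = (J+2)² − (M+1)²`. [folklore] -/
def yLev (J M : ℕ) : ℝ := ((J : ℝ) + 2) ^ 2 - ((M : ℝ) + 1) ^ 2

/-- **square-root-free majorant of the coupling drop** at level `J = J_k(M)`:
`dcU_k = (η/4)(2M+1)·½(β²_J+β²_{J+1})·(x′+y′)²/(4x′y′)` (set to `0` beyond `J + 2 ≤ n`). [folklore] -/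
def dcUK (n M : ℕ) (η : ℝ) (k : ℕ) : ℝ :=
  if lev n (M : ℤ) k + 2 ≤ n then
    η / 4 * (2 * (M : ℝ) + 1) * ((betaSq n (lev n (M : ℤ) k) + betaSq n (lev n (M : ℤ) k + 1)) / 2)
      * ((xLev (lev n (M : ℤ) k) M + yLev (lev n (M : ℤ) k) M) ^ 2
          / (4 * xLev (lev n (M : ℤ) k) M * yLev (lev n (M : ℤ) k) M))
  else 0

/-- `x′ ≥ 0` on the levels of sector `M` (`J ≥ M`). [folklore] -/
theorem xLev_nonneg {J M : ℕ} (h : M ≤ J) : 0 ≤ xLev J M := by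
  unfold xLev
  have : (M : ℝ) + 1 ≤ (J : ℝ) + 1 := by exact_mod_cast Nat.succ_le_succ h
  nlinarith [this, Nat.cast_nonneg (α := ℝ) M]

/-- `x′ > 0` for `J ≥ M + 1`. [folklore] -/
theorem xLev_pos {J M : ℕ} (h : M + 1 ≤ J) : 0 < xLev J M := by
  unfold xLev
  have : (M : ℝ) + 1 < (J : ℝ) + 1 := by exact_mod_cast Nat.lt_succ_of_le h
  nlinarith [this, Nat.cast_nonneg (α := ℝ) M]

/-- `y′ > 0` for `J ≥ M`. [folklore] -/
theorem yLev_pos {J M : ℕ} (h : M ≤ J) : 0 < yLev J M := by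
  unfold yLev
  have : (M : ℝ) + 1 < (J : ℝ) + 2 := by
    have : (M : ℝ) ≤ J := by exact_mod_cast h
    linarith
  nlinarith [this, Nat.cast_nonneg (α := ℝ) M]

/-- `dcU_k ≥ 0` (`η ≥ 0`). [folklore] -/
theorem dcUK_nonneg (n M : ℕ) {η : ℝ} (hη : 0 ≤ η) (k : ℕ) : 0 ≤ dcUK n M η k := by
  unfold dcUK
  split_ifs with hJ
  · have hMJ : M ≤ lev n (M : ℤ) k := by
      have := natAbs_le_lev n (M : ℤ) k; rwa [Int.natAbs_natCast] at this
    have hb1 : 0 ≤ betaSq n (lev n (M : ℤ) k) := betaSq_nonneg (by omega)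
    have hb2 : 0 ≤ betaSq n (lev n (M : ℤ) k + 1) := betaSq_nonneg (by omega)
    have hx := xLev_nonneg hMJ
    have hy := (yLev_pos hMJ).le
    positivity
  · exact le_rfl

/-- `dcU_k` is linear in `η`. [folklore] -/
theorem dcUK_linear (n M : ℕ) (η : ℝ) (k : ℕ) : dcUK n M η k = η * dcUK n M 1 k := by
  unfold dcUK; split_ifs <;> ring

/-- `b_J(M)² = (x′_J + (2M+1)) β²_J` for `J + 1 ≤ n`. [folklore] -/
theorem bSq_eq_xLev (n M J : ℕ) (hJ : J + 1 ≤ n) : bSq n (M : ℤ) J = (xLev J M + (2 * (M : ℝ) + 1)) * betaSq n J := by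
  unfold bSq xLev; rw [if_pos hJ]; push_cast; ring

/-- `b_{J+1}(M)² = (y′_J + (2M+1)) β²_{J+1}` for `J + 2 ≤ n`. [folklore] -/
theorem bSq_succ_eq_yLev (n M J : ℕ) (hJ : J + 2 ≤ n) :
    bSq n (M : ℤ) (J + 1) = (yLev J M + (2 * (M : ℝ) + 1)) * betaSq n (J + 1) := by
  unfold bSq yLev; rw [if_pos (by omega)]; push_cast; ring

/-- `b_J(M+1)² = x′_J β²_J` for `J + 1 ≤ n`. [folklore] -/
theorem bSq_succM_eq_xLev (n M J : ℕ) (hJ : J + 1 ≤ n) : bSq n ((M : ℤ) + 1) J = xLev J M * betaSq n J := by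
  unfold bSq xLev; rw [if_pos hJ]; push_cast; ring

/-- `b_{J+1}(M+1)² = y′_J β²_{J+1}` for `J + 2 ≤ n`. [folklore] -/
theorem bSq_succM_succ_eq_yLev (n M J : ℕ) (hJ : J + 2 ≤ n) :
    bSq n ((M : ℤ) + 1) (J + 1) = yLev J M * betaSq n (J + 1) := by
  unfold bSq yLev; rw [if_pos (by omega)]; push_cast; ring

/-- **the coupling drop is majorised by `dcU`:** `c_{k+shift}(M) − c_k(M+1) ≤ dcU_{k+shift}` on the couplings of
sector `M+1` (`J_k(M+1) + 2 ≤ n`). [folklore] -/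
theorem cK_sub_le_dcUK (n M : ℕ) {η : ℝ} (hη : 0 ≤ η) {k : ℕ} (hk : lev n ((M : ℤ) + 1) k + 2 ≤ n) :
    cK n (M : ℤ) η (k + shift n M) - cK n ((M : ℤ) + 1) η k ≤ dcUK n M η (k + shift n M) := by
  unfold cK dcUK
  rw [← lev_succ]
  set J := lev n ((M : ℤ) + 1) k with hJdef
  rw [if_pos hk]
  have hMJ : M + 1 ≤ J := by
    have := natAbs_le_lev n ((M : ℤ) + 1) k; rwa [natAbs_natCast_succ] at this
  have hx := xLev_pos hMJ
  have hy := yLev_pos (by omega : M ≤ J)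
  have hb1 : 0 ≤ betaSq n J := betaSq_nonneg (by omega)
  have hb2 : 0 ≤ betaSq n (J + 1) := betaSq_nonneg (by omega)
  set δ : ℝ := 2 * (M : ℝ) + 1 with hδ
  have hδ0 : 0 ≤ δ := by positivity
  rw [bSq_eq_xLev n M J (by omega), bSq_succ_eq_yLev n M J hk, bSq_succM_eq_xLev n M J (by omega),
    bSq_succM_succ_eq_yLev n M J hk]
  set x := xLev J M
  set y := yLev J M
  set B := betaSq n J * betaSq n (J + 1) with hB
  have hB0 : 0 ≤ B := mul_nonneg hb1 hb2
  have e1 : (x + δ) * betaSq n J * ((y + δ) * betaSq n (J + 1)) = ((x + δ) * (y + δ)) * B := by rw [hB]; ring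
  have e2 : x * betaSq n J * (y * betaSq n (J + 1)) = (x * y) * B := by rw [hB]; ring
  rw [e1, e2, Real.sqrt_mul (by positivity) B, Real.sqrt_mul (by positivity) B]
  have hsqB : Real.sqrt B ≤ (betaSq n J + betaSq n (J + 1)) / 2 := by
    have amgm : ∀ a b : ℝ, 0 ≤ a → 0 ≤ b → Real.sqrt (a * b) ≤ (a + b) / 2 := by
      intro a b ha hb
      have h : a * b ≤ ((a + b) / 2) ^ 2 := by nlinarith [sq_nonneg (a - b)]
      calc Real.sqrt (a * b) ≤ Real.sqrt (((a + b) / 2) ^ 2) := Real.sqrt_le_sqrt h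
        _ = (a + b) / 2 := Real.sqrt_sq (by linarith)
    exact amgm _ _ hb1 hb2
  have htan := sqrt_mul_sub_sqrt_mul_le hx hy hδ0
  have hdiff0 : 0 ≤ Real.sqrt ((x + δ) * (y + δ)) - Real.sqrt (x * y) := by
    have : x * y ≤ (x + δ) * (y + δ) := by nlinarith
    linarith [Real.sqrt_le_sqrt this]
  have hq0 : 0 ≤ δ * (x + y) ^ 2 / (4 * x * y) := by positivity
  have hsB0 : 0 ≤ Real.sqrt B := Real.sqrt_nonneg _
  calc η / 4 * (Real.sqrt ((x + δ) * (y + δ)) * Real.sqrt B) - η / 4 * (Real.sqrt (x * y) * Real.sqrt B)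
      = η / 4 * ((Real.sqrt ((x + δ) * (y + δ)) - Real.sqrt (x * y)) * Real.sqrt B) := by ring
    _ ≤ η / 4 * ((δ * (x + y) ^ 2 / (4 * x * y)) * ((betaSq n J + betaSq n (J + 1)) / 2)) := by
        apply mul_le_mul_of_nonneg_left _ (by positivity)
        exact mul_le_mul htan hsqB hsB0 hq0
    _ = η / 4 * (2 * (M : ℝ) + 1) * ((betaSq n J + betaSq n (J + 1)) / 2) * ((x + y) ^ 2 / (4 * x * y)) := by
        rw [hδ]; ring

/-! ## The ratio-majorant criterion for (S_M) -/

/-- `shift ≤ 1`. [folklore] -/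
theorem shift_le_one (n M : ℕ) : shift n M ≤ 1 := by unfold shift; split_ifs <;> omega

/-- **(S_M) FROM RATIO BOUNDS:** for `M + 4 ≤ n`, `η > 0`, any `T` with positive brackets
`p_top − p_k − cU_{k−1}T_{k−1}` and `cU_k ≤ T_k · bracket_k` on the levels of sector `M`, the Horner value
`H_{m′−1}(d, dcU, cU, T)` bounds the drop of the Perron root from `M` to `M+1`; if it is `≤ budget`, the budget condition
(S_M) holds. [folklore] -/
theorem budgetCondition_of_ratioBounds {n M : ℕ} (hM : M + 4 ≤ n) {η : ℝ} (hη : 0 < η) (T : ℕ → ℝ)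
    (hden : ∀ k, k + 1 < numLevels n (M : ℤ) →
      0 < bracket (numLevels n (M : ℤ)) (pK n (M : ℤ) η) (cUK n (M : ℤ) η) T k)
    (hT : ∀ k, k + 1 < numLevels n (M : ℤ) →
      cUK n (M : ℤ) η k ≤ T k * bracket (numLevels n (M : ℤ)) (pK n (M : ℤ) η) (cUK n (M : ℤ) η) T k)
    (hH : horner (dK n M η) (dcUK n M η) (cUK n (M : ℤ) η) T (shift n M) (numLevels n ((M : ℤ) + 1) - 1)
      ≤ budget n M η) :
    BudgetCondition n M η := by
  intro x x' hx hx'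
  simp only [knnBlock_eq_jac] at hx hx' ⊢
  have hms : numLevels n (M : ℤ) = numLevels n ((M : ℤ) + 1) + shift n M := numLevels_succ n M (by omega)
  have hMabs : ((M : ℤ)).natAbs ≤ n := by rw [Int.natAbs_natCast]; omega
  have hM1abs : ((M : ℤ) + 1).natAbs ≤ n := by rw [natAbs_natCast_succ]; omega
  have key := rayleigh_sub_le_horner hms (shift_le_one n M) (numLevels_pos n _)
    (p := pK n (M : ℤ) η) (c := cK n (M : ℤ) η) (p' := pK n ((M : ℤ) + 1) η) (c' := cK n ((M : ℤ) + 1) η)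
    (cU := cUK n (M : ℤ) η) (dcU := dcUK n M η) (T := T)
    (fun k hk => cK_pos hMabs hη hk) (fun k _ => cK_le_cUK n _ hη.le k)
    (fun k hk => cK_sub_le_dcUK n M hη.le (lev_add_two_le n hM1abs hk))
    (fun k => dcUK_nonneg n M hη.le k) (fun k _ => dK_nonneg n M hη.le k) hden hT hx hx'
  exact key.trans hH

/-! ## Monotone coverage in `η` -/

/-- the `η`-free part of the bracket is the bare level gap, which is `≥ 0`; the rest is linear:
`bracket(η) = A_k + η B_k` with `A_k = ½(J_top(J_top+1) − J_k(J_k+1)) ≥ 0`. [folklore] -/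
theorem bracket_affine (n : ℕ) (M : ℤ) (T : ℕ → ℝ) (η : ℝ) (k : ℕ) :
    bracket (numLevels n M) (pK n M η) (cUK n M η) T k
      = (fK n M (numLevels n M - 1) - fK n M k) / 2
        + η * (bracket (numLevels n M) (pK n M 1) (cUK n M 1) T k - (fK n M (numLevels n M - 1) - fK n M k) / 2) := by
  unfold bracket pK cUK fK
  split_ifs <;> ring

/-- **MONOTONE COVERAGE:** ratio bounds checked at `η₀` prove (S_M) at every `0 < η ≤ η₀`. [folklore] -/
theorem budgetCondition_of_ratioBounds_of_le {n M : ℕ} (hM : M + 4 ≤ n) {η₀ η : ℝ} (hη : 0 < η) (hle : η ≤ η₀)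
    (T : ℕ → ℝ)
    (hden : ∀ k, k + 1 < numLevels n (M : ℤ) →
      0 < bracket (numLevels n (M : ℤ)) (pK n (M : ℤ) η₀) (cUK n (M : ℤ) η₀) T k)
    (hT : ∀ k, k + 1 < numLevels n (M : ℤ) →
      cUK n (M : ℤ) η₀ k ≤ T k * bracket (numLevels n (M : ℤ)) (pK n (M : ℤ) η₀) (cUK n (M : ℤ) η₀) T k)
    (hH : horner (dK n M η₀) (dcUK n M η₀) (cUK n (M : ℤ) η₀) T (shift n M) (numLevels n ((M : ℤ) + 1) - 1)
      ≤ budget n M η₀) :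
    BudgetCondition n M η := by
  have hη₀ : 0 < η₀ := hη.trans_le hle
  set r := η / η₀ with hr
  have hr0 : 0 < r := div_pos hη hη₀
  have hr1 : r ≤ 1 := (div_le_one hη₀).mpr hle
  have hηr : η = r * η₀ := by rw [hr, div_mul_cancel₀ _ hη₀.ne']
  set m := numLevels n (M : ℤ) with hm
  have hMabs : ((M : ℤ)).natAbs ≤ n := by rw [Int.natAbs_natCast]; omega
  -- T ≥ 0 (from the data at η₀)
  have hTnn : ∀ k, k + 1 < m → 0 ≤ T k := fun k hk =>
    (ratio_pos (fun j hj => cK_pos hMabs hη₀ hj) (fun j _ => cK_le_cUK n _ hη₀.le j) hden hT hk).le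
  -- brackets: bracket(η) ≥ r · bracket(η₀)
  have hbr : ∀ k, k + 1 < m →
      r * bracket m (pK n (M : ℤ) η₀) (cUK n (M : ℤ) η₀) T k ≤ bracket m (pK n (M : ℤ) η) (cUK n (M : ℤ) η) T k := by
    intro k hk
    rw [hm, bracket_affine n (M : ℤ) T η k, bracket_affine n (M : ℤ) T η₀ k, ← hm]
    have hA : 0 ≤ (fK n (M : ℤ) (m - 1) - fK n (M : ℤ) k) / 2 := by
      have := fK_mono n (M : ℤ) (show k ≤ m - 1 by omega); linarith
    set A := (fK n (M : ℤ) (m - 1) - fK n (M : ℤ) k) / 2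
    set B := bracket m (pK n (M : ℤ) 1) (cUK n (M : ℤ) 1) T k - A
    rw [hηr]
    nlinarith [mul_nonneg (sub_nonneg.mpr hr1) hA]
  have hden' : ∀ k, k + 1 < m → 0 < bracket m (pK n (M : ℤ) η) (cUK n (M : ℤ) η) T k := by
    intro k hk
    exact lt_of_lt_of_le (mul_pos hr0 (hden k hk)) (hbr k hk)
  have hT' : ∀ k, k + 1 < m → cUK n (M : ℤ) η k ≤ T k * bracket m (pK n (M : ℤ) η) (cUK n (M : ℤ) η) T k := by
    intro k hk
    have h1 := hT k hk
    have h2 := hbr k hk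
    have h3 := hTnn k hk
    calc cUK n (M : ℤ) η k = r * cUK n (M : ℤ) η₀ k := by rw [cUK_linear n _ η, cUK_linear n _ η₀, hηr]; ring
      _ ≤ r * (T k * bracket m (pK n (M : ℤ) η₀) (cUK n (M : ℤ) η₀) T k) := mul_le_mul_of_nonneg_left h1 hr0.le
      _ = T k * (r * bracket m (pK n (M : ℤ) η₀) (cUK n (M : ℤ) η₀) T k) := by ring
      _ ≤ T k * bracket m (pK n (M : ℤ) η) (cUK n (M : ℤ) η) T k := mul_le_mul_of_nonneg_left h2 h3
  -- Horner scales linearly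
  have hhor : ∀ j, horner (dK n M η) (dcUK n M η) (cUK n (M : ℤ) η) T (shift n M) j
      = r * horner (dK n M η₀) (dcUK n M η₀) (cUK n (M : ℤ) η₀) T (shift n M) j := by
    intro j
    induction j with
    | zero =>
      simp only [horner_zero]
      rw [dK_linear n M η, dK_linear n M η₀, cUK_linear n _ η, cUK_linear n _ η₀, hηr]
      split_ifs <;> ring
    | succ j ih =>
      simp only [horner_succ]
      rw [ih, dK_linear n M η, dK_linear n M η₀, dcUK_linear n M η, dcUK_linear n M η₀, hηr]
      ring
  have hbud : budget n M η = r * budget n M η₀ := by unfold budget; rw [hηr]; ring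
  apply budgetCondition_of_ratioBounds hM hη T hden' hT'
  rw [hhor, hbud]
  exact mul_le_mul_of_nonneg_left hH hr0.le

end Summit.HubbardSuperconductivity.HubbardSuperconductivity.Theorems.AnisotropyChord.Knn
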